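import Literature.AlgebraicGeometry.CossartPiltant200819.DiscreteDescent2008
import Literature.AlgebraicGeometry.CossartPiltant200819.ArcDescent2008
import HarnessLib

/-!
# Cossart–Piltant 2008, Lemma 9.4: the sharpest dependency statement of the cluster (universe 0)

Topic: `Literature/AlgebraicGeometry/CossartPiltant200819`.  One-line compositions of
`DiscreteDescent2008.lean` ([KnafKuhlmann2009] Thm. 1.5: the sub-case "`V` discrete with finite
separable residue extension" of the rank-one residual is irrelevant for Lemma 9.4) with
`ArcDescent2008.lean` ([BenitoPiltantReguera2022] Prop. 2.3: (S3\*) holds for `W` discrete over a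
perfect ground field): Lemma 9.4 (`TamePrimeDescent`, universe `0`) follows from the printed
leaves, the transport, the two printed theorems and the two sub-cases "`W` NOT discrete" (any `k`)
and "`W` discrete, `k` imperfect, `κ(V)/k` not finite separable" of (S3\*) in rational rank one.
PROVED bookkeeping; no statement of [CP-I] is asserted.  (Filed while the farm had not yet built the
two imported modules — the gate verifies it once they are; pub-hironaka GAPS rider G22-A21.S-D.)

## References

* [CossartPiltant2008] HAL hal-00139124v1, Lemma 9.4 (p. 29–30).
* [KnafKuhlmann2009] Thm. 1.5.  * [BenitoPiltantReguera2022] Prop. 2.3 (HAL hal-01945228v1 p. 7).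
-/

namespace Literature.AlgebraicGeometry.CossartPiltant200819.CP2008

open Literature.AlgebraicGeometry.Resolution
open scoped Pointwise IntermediateField


/-! ### Universe `0`: combined with Knaf–Kuhlmann 2009 Thm. 1.5 (`DiscreteDescent2008.lean`) -/

/-- **(S3\*) in rational rank one, DISCRETE sub-case over an IMPERFECT ground field, CORE**
(universe `0`): the residual restricted to `k` imperfect, `W` discrete and `V = W ∩ K` NOT a
discrete valuation ring with residue field `k(ȳ)`, `ȳ` separable algebraic over `k` (that
sub-case being irrelevant for Lemma 9.4 by `descent_of_isDiscreteWithSeparableResidue`,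
[KnafKuhlmann2009] Thm. 1.5).  Hypothesis only (pub-hironaka GAPS rider G22-A21.S-D).
[cite: CossartPiltant2008, Lemma 9.4 proof (HAL p. 30, l. 11–16)] -/
def GStableUniformizationInertialRankOneDiscreteImperfectCore : Prop :=
  ∀ (k K : Type) [Field k] [Field K] [Algebra k K], (⊤ : IntermediateField k K).FG →
    Algebra.trdeg k K = 3 →
    ∀ (L : Type) [Field L] [Algebra K L] [Algebra k L] [IsScalarTower k K L],
      FiniteDimensional K L → IsGalois K L →
      (Module.finrank K L).Prime → ((Module.finrank K L : ℕ) : K) ≠ 0 →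
      ∀ (W : ValuationSubring L) (hk : ∀ c : k, algebraMap k L c ∈ W),
        Nonempty W.valuation.RankOne → residueTrdeg k W hk = 0 → ratRank W < 2 →
          (∀ σ : L ≃ₐ[K] L, InInertiaGroup K W σ) →
          IsLocallyUniformizable k L W →
          ¬ IsDiscreteWithSeparableResidue k (W.comap (algebraMap K L)) →
          IsDiscreteValuationRing W → ¬ PerfectField k →
          ∀ R₀ : Subalgebra k K, IsNormalLocalModelOf k K (W.comap (algebraMap K L)) R₀ →
            GStableUniformizationAbove (K := K) W R₀

/-- The core discrete-imperfect sub-case is a weakening of the discrete-imperfect sub-case (in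
universe `0`). [folklore] -/
theorem GStableUniformizationInertialRankOneDiscreteImperfect.core
    (h : GStableUniformizationInertialRankOneDiscreteImperfect.{0}) :
    GStableUniformizationInertialRankOneDiscreteImperfectCore :=
  fun k K _ _ _ hfg htr L _ _ _ _ hfd hgal hpr hl W hk hrk hres hrr hin hLU _ hW hp R₀ hR₀ =>
    h k K hfg htr L hfd hgal hpr hl W hk hrk hres hrr hin hLU hW hp R₀ hR₀

/-- **The CORE residual splits** (universe `0`, PROVED bookkeeping):
`GStableUniformizationInertialRankOneCore` of `DiscreteDescent2008.lean` follows from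
[BPR 2022, Prop. 2.3], the non-discrete sub-case and the core discrete-imperfect sub-case.
[cite: CossartPiltant2008, Lemma 9.4 proof (HAL p. 30, l. 11–16); BenitoPiltantReguera2022, Prop. 2.3 (HAL hal-01945228v1 p. 7)] -/
theorem gStableUniformizationInertialRankOneCore_of_cases
    (hBPR : BenitoPiltantReguera2022QuadraticSequence.{0})
    (hnd : GStableUniformizationInertialRankOneNonDiscrete.{0})
    (hdic : GStableUniformizationInertialRankOneDiscreteImperfectCore) :
    GStableUniformizationInertialRankOneCore := by
  intro k K _ _ _ hfg htr L _ _ _ _ hfd hgal hpr hl W hk hrk hres hrr hin hLU hnsr R₀ hR₀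
  by_cases hW : IsDiscreteValuationRing W
  · by_cases hp : PerfectField k
    · haveI := hp
      haveI := hfd
      exact gStableUniformizationAbove_of_isDiscreteValuationRing hBPR hfg W hk hW
        (fun σ => by
          obtain ⟨hσ, -⟩ := hin σ
          exact MulAction.mem_stabilizer_iff.mp hσ) R₀ hR₀
    · exact hdic k K hfg htr L hfd hgal hpr hl W hk hrk hres hrr hin hLU hnsr hW hp R₀ hR₀
  · exact hnd k K hfg htr L hfd hgal hpr hl W hk hrk hres hrr hin hLU hW R₀ hR₀

/-- **Lemma 9.4 (`TamePrimeDescent`, universe `0`) from the printed leaves, the transport,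
[KnafKuhlmann2009] Thm. 1.5, [BPR 2022] Prop. 2.3 and the two remaining sub-cases of (S3\*) in
rational rank one** — "`W` not discrete" (any `k`) and "`W` discrete, `k` imperfect,
`κ(V)/k` not finite separable" (PROVED bookkeeping: `tamePrimeDescent_of_printed_leaves_core`
fed with `gStableUniformizationInertialRankOneCore_of_cases`).  This is the sharpest dependency
statement of the cluster for CP 2008 Lemma 9.4.
[cite: CossartPiltant2008, Lemma 9.4 (HAL p. 29–30); KnafKuhlmann2009, Thm. 1.5; BenitoPiltantReguera2022, Prop. 2.3 (HAL hal-01945228v1 p. 7)] -/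
theorem tamePrimeDescent_of_printed_leaves_cases₀ (h93 : DescentBelowInertiaField.{0})
    (h₁ : TamePrimeDescentViaStableModel.{0}) (hcof : Cofinality.{0})
    (hFu : PrimaryTransformRankOne.{0}) (hKK : KnafKuhlmann2009MonogenicCompletion)
    (hBPR : BenitoPiltantReguera2022QuadraticSequence.{0})
    (hnd : GStableUniformizationInertialRankOneNonDiscrete.{0})
    (hdic : GStableUniformizationInertialRankOneDiscreteImperfectCore) : TamePrimeDescent.{0} :=
  tamePrimeDescent_of_printed_leaves_core h93 h₁ hcof hFu hKK
    (gStableUniformizationInertialRankOneCore_of_cases hBPR hnd hdic)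

end Literature.AlgebraicGeometry.CossartPiltant200819.CP2008
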